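import Literature.Barriers.CriticalPhenomena.LaceExpansionFourierIdentity
import Literature.Barriers.CriticalPhenomena.LaceExpansionKernelFourier
import Mathlib.MeasureTheory.Integral.IntervalIntegral.Periodic
import Mathlib.Algebra.Group.EvenFunction
import HarnessLib

/-!
# Lattice Fourier analysis for the convergence of the lace expansion (Slade 2006, §5.1):
# real forms of inversion and Parseval for the cosine transform, the second difference
# `-½ Δ_k` ((5.11)–(5.14)), and translation invariance on the torus `[-π,π]^d`

Infrastructure for the discharge of `Literature.Barriers.CriticalPhenomena.Slade2006_thm58`
(Theorem 5.8, `LaceExpansionConvergence.lean`), on top of the tree's lattice-Fourier layer: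

* the real cosine transform `cosFT f k = Σ_x cos(k·x) f(x)` (`GaussianDominationRouteImprovement.lean`;
  `twoPointFT d z = cosFT G_z`, `LaceExpansionBubbleInfrared.lean`) and Hara's complex
  `latticeFT f k = Σ_x f(x) e^{-ik·x}` (`LaceExpansionXSpaceAsymptotics.lean`) with its API
  (`continuous_latticeFT`, `norm_latticeFT_le`, the inversion `integral_cexp_kdot_mul_latticeFT`
  — `LaceExpansionPcInputs.lean`; `latticeFT_eq_re_of_even` — `LaceExpansionKernelFourier.lean`;
  `latticeFT_conv` and (3.30) — `LaceExpansionFourierIdentity.lean`; Parseval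
  `tsum_enorm_sq_eq_lintegral_latticeFT` — `LaceExpansionBubbleInfrared.lean`; orthogonality
  `Percolation.integral_cexp_neg_kdot` — `InfraredTriangleAnalysis.lean`);
* Slade's Lemma 5.7 is the tree's `slade_lemma82`, and the convolution theorem for `cosFT` is
  `cosFT_conv` (`GaussianDominationRoute{SladeLemma,LatticeConv}.lean`) — not repeated here.

What this file adds (namespace `Literature.Barriers.CriticalPhenomena.LaceExpansion`), for
absolutely summable `f : ℤ^d → ℝ`, EVEN where stated (every function met in Chapter 5 —
`G_z`, `H_z`, `D`, `Π_z`, `D * G_z`, `[1 - cos(k·x)] G_z(x)` — is even):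
* the bridge `latticeFT_eq_ofReal_cosFT` (`f̂ = cosFT f` for even `f`), continuity, `2π`-periodicity
  and linearity of `cosFT`;
* REAL forms over the cube `[-π,π]^d` (set integrals `∫ k in cube d`): orthogonality
  `integral_cos_kdot`, **inversion** `integral_cosFT_mul_cos` ((1.7)) with the bound
  **`‖f‖_∞ ≤ ‖f̂‖₁`** `abs_le_integral_abs_cosFT` ("the general fact" used in (5.12), (5.43)), and
  **Parseval** `integral_cosFT_sq` ((2.31): `∫ f̂² dk = (2π)^d Σ_x f(x)²`);
* the modulation identity (5.11)/(5.19) `tsum_mul_cos_mul_cos`, the second difference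
  `halfNegLap A k l = -½ Δ_k A(l) = A(l) - ½[A(l+k) + A(l-k)]` ((5.13)) with
  `cosFT_one_sub_cos_mul` (the transform of `[1 - cos(k·x)] f(x)` is `-½ Δ_k f̂`) and the
  consequence (5.12)/(5.14)/(5.39) `abs_one_sub_cos_mul_le`:
  `(2π)^d ‖[1 - cos(k·x)] f(x)‖_∞ ≤ ∫ |½ Δ_k f̂(l)| dl`;
* **translation invariance** of integrals of `2π`-periodic functions over the cube
  (`lintegral_cube_comp_add`, change of variables on the torus `(ℝ/2πℤ)^d`), which gives
  `∫ Ĉ(l ± k)² dl = ‖Ĉ‖₂²` in (5.18) and (5.40).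
-/

noncomputable section

open MeasureTheory Filter Real Finset Function
open Literature.Probability.LatticeModels (Site)
open Literature.Probability.Percolation (kdot_add kdot_neg integral_cexp_neg_kdot)
open scoped BigOperators ENNReal Topology

namespace Literature.Barriers.CriticalPhenomena

namespace LaceExpansion

open Slade2006Prop53

variable {d : ℕ}

/-! ### `kdot` and `2π`-periodicity -/

/-- `(-k)·x = -k·x`. [folklore] -/
theorem neg_kdot (k : Fin d → ℝ) (x : Site d) : kdot (-k) x = -kdot k x := by
  simp [kdot, sum_neg_distrib]

/-- Shifting `k` by `2π n` (`n ∈ ℤ^d`) changes `k·x` by an integer multiple of `2π`. [folklore] -/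
theorem kdot_add_twoPi_mul (k : Fin d → ℝ) (n : Fin d → ℤ) (x : Site d) :
    kdot (fun j => k j + 2 * π * n j) x = kdot k x + ((∑ j, n j * x j : ℤ) : ℝ) * (2 * π) := by
  simp only [kdot, add_mul, sum_add_distrib, Int.cast_sum, Int.cast_mul, sum_mul]
  congr 1
  exact sum_congr rfl fun j _ => by ring

/-- `cos(k·x)` is `2π`-periodic in each coordinate of `k`. [folklore] -/
theorem cos_kdot_add_twoPi_mul (k : Fin d → ℝ) (n : Fin d → ℤ) (x : Site d) :
    Real.cos (kdot (fun j => k j + 2 * π * n j) x) = Real.cos (kdot k x) := by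
  rw [kdot_add_twoPi_mul, Real.cos_add_int_mul_two_pi]

/-! ### The cosine transform of an `ℓ¹` function: bridge to `latticeFT`, continuity, linearity -/

section CosFT

variable {f g : Site d → ℝ}

/-- `cosFT f k = Σ_x f(x) cos(k·x)` (the order of factors used by `latticeFT_eq_re_of_even`). [folklore] -/
theorem cosFT_eq_tsum_mul_cos (f : Site d → ℝ) (k : Fin d → ℝ) :
    cosFT f k = ∑' x, f x * Real.cos (kdot k x) := by
  unfold cosFT; simp_rw [mul_comm]

/-- **Bridge**: for an even `f ∈ ℓ¹`, Hara's transform is the cosine transform,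
`latticeFT f k = cosFT f k` (as a real number cast to `ℂ`). [folklore] -/
theorem latticeFT_eq_ofReal_cosFT (hf : Summable fun x => |f x|) (hfe : Function.Even f)
    (k : Fin d → ℝ) : latticeFT f k = (cosFT f k : ℂ) := by
  rw [latticeFT_eq_re_of_even hf hfe k, cosFT_eq_tsum_mul_cos]

/-- For `f ∈ ℓ¹` the terms of `cosFT f k` are dominated by `|f|`, uniformly in `k`. [folklore] -/
theorem norm_cos_mul_le (f : Site d → ℝ) (k : Fin d → ℝ) (x : Site d) :
    ‖Real.cos (kdot k x) * f x‖ ≤ |f x| := by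
  rw [norm_mul, Real.norm_eq_abs, Real.norm_eq_abs]
  exact mul_le_of_le_one_left (abs_nonneg _) (abs_cos_le_one _)

/-- `cosFT f` is continuous for `f ∈ ℓ¹` (uniformly convergent series). [folklore] -/
theorem continuous_cosFT (hf : Summable fun x => |f x|) : Continuous (cosFT f) := by
  unfold cosFT
  exact continuous_tsum (fun x => by unfold kdot; fun_prop) hf fun x k => norm_cos_mul_le f k x

/-- `cosFT f` is even in `k`. [folklore] -/
theorem cosFT_neg_arg (f : Site d → ℝ) (k : Fin d → ℝ) : cosFT f (-k) = cosFT f k := by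
  simp [cosFT, neg_kdot, Real.cos_neg]

/-- `cosFT f` is `2π`-periodic in each coordinate. [folklore] -/
theorem cosFT_add_twoPi_mul (f : Site d → ℝ) (k : Fin d → ℝ) (n : Fin d → ℤ) :
    cosFT f (fun j => k j + 2 * π * n j) = cosFT f k := by
  simp only [cosFT, cos_kdot_add_twoPi_mul]

/-- Linearity: `(c f)^ = c f̂`. [folklore] -/
theorem cosFT_const_mul (c : ℝ) (f : Site d → ℝ) (k : Fin d → ℝ) :
    cosFT (fun x => c * f x) k = c * cosFT f k := by
  unfold cosFT
  rw [← tsum_mul_left]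
  exact tsum_congr fun x => by ring

/-- Linearity: `(f + g)^ = f̂ + ĝ` for `f, g ∈ ℓ¹`. [folklore] -/
theorem cosFT_add (hf : Summable fun x => |f x|) (hg : Summable fun x => |g x|) (k : Fin d → ℝ) :
    cosFT (fun x => f x + g x) k = cosFT f k + cosFT g k := by
  unfold cosFT
  rw [← (summable_cos_kdot_mul hf.of_abs k).tsum_add (summable_cos_kdot_mul hg.of_abs k)]
  exact tsum_congr fun x => by ring

/-- Linearity: `(f - g)^ = f̂ - ĝ` for `f, g ∈ ℓ¹`. [folklore] -/
theorem cosFT_sub (hf : Summable fun x => |f x|) (hg : Summable fun x => |g x|) (k : Fin d → ℝ) :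
    cosFT (fun x => f x - g x) k = cosFT f k - cosFT g k := by
  unfold cosFT
  rw [← (summable_cos_kdot_mul hf.of_abs k).tsum_sub (summable_cos_kdot_mul hg.of_abs k)]
  exact tsum_congr fun x => by ring

end CosFT

/-! ### The cube `[-π,π]^d`: total mass, integrability of bounded continuous functions -/

section Cube

/-- `vol([-π,π]^d) = (2π)^d`. [folklore] -/
theorem P_univ (d : ℕ) : P d Set.univ = ENNReal.ofReal ((2 * π) ^ d) := by
  rw [P, Measure.pi_univ]
  have : μI Set.univ = ENNReal.ofReal (2 * π) := by
    rw [μI, Measure.restrict_apply_univ, Real.volume_Icc]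
    congr 1; ring
  simp only [this, prod_const, card_univ, Fintype.card_fin]
  rw [ENNReal.ofReal_pow (by positivity)]

/-- `vol([-π,π]^d) = (2π)^d` (real version). [folklore] -/
theorem P_real_univ (d : ℕ) : (P d).real Set.univ = (2 * π) ^ d := by
  rw [Measure.real, P_univ, ENNReal.toReal_ofReal (by positivity)]

/-- Lebesgue measure restricted to `cube d = [-π,π]^d` is the product measure `P d`. [folklore] -/
theorem volume_restrict_cube_eq : (volume.restrict (cube d) : Measure (Fin d → ℝ)) = P d :=
  volume_restrict_cube d

/-- A continuous function bounded by `C` is integrable over the cube. [folklore] -/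
theorem integrable_of_norm_le {E : Type*} [NormedAddCommGroup E] {φ : (Fin d → ℝ) → E}
    (hφ : Continuous φ) {C : ℝ} (hC : ∀ k, ‖φ k‖ ≤ C) : Integrable φ (P d) :=
  (integrable_const C).mono' hφ.aestronglyMeasurable (ae_of_all _ hC)

/-- `∫ ‖φ‖ ≤ (2π)^d C` for `‖φ‖ ≤ C`. [folklore] -/
theorem integral_norm_le_of_norm_le {E : Type*} [NormedAddCommGroup E] {φ : (Fin d → ℝ) → E}
    {C : ℝ} (hC : ∀ k, ‖φ k‖ ≤ C) : ∫ k, ‖φ k‖ ∂P d ≤ (2 * π) ^ d * C := by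
  calc ∫ k, ‖φ k‖ ∂P d ≤ ∫ _k, C ∂P d := integral_mono_of_nonneg (ae_of_all _ fun _ => norm_nonneg _)
        (integrable_const C) (ae_of_all _ hC)
    _ = (2 * π) ^ d * C := by rw [integral_const, smul_eq_mul, P_real_univ]

end Cube

/-! ### Orthogonality, inversion and Parseval in real form -/

section Inversion

variable {f : Site d → ℝ}

/-- **Orthogonality** (real form of `Percolation.integral_cexp_neg_kdot`):
`∫_{[-π,π]^d} cos(k·x) dk = (2π)^d δ_{x,0}` for `x ∈ ℤ^d`. (The same statement is
`SpreadOutIsing.integral_cube_cos_kdot` in the Ising layer `LaceExpansionIsingRandomWalkBound.lean`,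
which is deliberately not imported into the self-avoiding-walk chain; here it is a 15-line corollary
of the percolation toolbox already imported.) [cite: Slade2006LaceExpansion, eq. (1.7)] -/
theorem integral_cos_kdot (x : Site d) :
    ∫ k in cube d, Real.cos (kdot k x) = if x = 0 then (2 * π) ^ d else 0 := by
  rw [volume_restrict_cube_eq]
  have hF : Integrable (fun k : Fin d → ℝ => Complex.exp (-(Complex.I * ((kdot k x : ℝ) : ℂ)))) (P d) := by
    refine integrable_of_norm_le (by unfold kdot; fun_prop) (C := 1) fun k => le_of_eq ?_
    rw [show -(Complex.I * ((kdot k x : ℝ) : ℂ)) = ((-kdot k x : ℝ) : ℂ) * Complex.I by push_cast; ring,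
      Complex.norm_exp_ofReal_mul_I]
  have hre : ∀ k : Fin d → ℝ, Real.cos (kdot k x) =
      (Complex.exp (-(Complex.I * ((kdot k x : ℝ) : ℂ)))).re := fun k => by
    rw [show -(Complex.I * ((kdot k x : ℝ) : ℂ)) = ((-kdot k x : ℝ) : ℂ) * Complex.I by push_cast; ring,
      Complex.exp_ofReal_mul_I_re, Real.cos_neg]
  simp_rw [hre]
  have h1 := integral_re hF
  simp only [RCLike.re_to_complex] at h1
  rw [h1, integral_cexp_neg_kdot x]
  split_ifs
  · norm_cast
  · simp

/-- `∫ cos(k·x) cos(k·y) dk = ½ (2π)^d (δ_{x,y} + δ_{x,-y})`. [folklore] -/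
theorem integral_cos_kdot_mul_cos_kdot (x y : Site d) :
    ∫ k in cube d, Real.cos (kdot k x) * Real.cos (kdot k y) =
      (2 * π) ^ d * (((if x = y then 1 else 0) + if x = -y then 1 else 0) / 2) := by
  have h : ∀ k : Fin d → ℝ, Real.cos (kdot k x) * Real.cos (kdot k y) =
      (1 / 2) * Real.cos (kdot k (x - y)) + (1 / 2) * Real.cos (kdot k (x + y)) := by
    intro k
    rw [sub_eq_add_neg, kdot_add, kdot_neg, kdot_add, ← sub_eq_add_neg, Real.cos_sub, Real.cos_add]
    ring
  simp_rw [h]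
  have hi : ∀ v : Site d, Integrable (fun k : Fin d → ℝ => Real.cos (kdot k v)) (volume.restrict (cube d)) :=
    fun v => by
      rw [volume_restrict_cube_eq]
      exact integrable_of_norm_le (by unfold kdot; fun_prop) (C := 1) fun k => by
        simpa using abs_cos_le_one (kdot k v)
  rw [integral_add ((hi _).const_mul _) ((hi _).const_mul _), integral_const_mul,
    integral_const_mul, integral_cos_kdot, integral_cos_kdot]
  simp only [sub_eq_zero, add_eq_zero_iff_eq_neg]
  split_ifs <;> ring

/-- **Fourier inversion, real form** ((1.7)): for an even `f ∈ ℓ¹`,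
`∫_{[-π,π]^d} f̂(k) cos(k·x) dk = (2π)^d f(x)` (the real part of the tree's
`integral_cexp_kdot_mul_latticeFT`). [cite: Slade2006LaceExpansion, eq. (1.7)] -/
theorem integral_cosFT_mul_cos (hf : Summable fun x => |f x|) (hfe : Function.Even f) (x : Site d) :
    ∫ k in cube d, cosFT f k * Real.cos (kdot k x) = (2 * π) ^ d * f x := by
  have h := integral_cexp_kdot_mul_latticeFT hf x
  have hint : Integrable (fun k => Complex.exp (Complex.I * (kdot k x : ℂ)) * latticeFT f k)
      (volume.restrict (cube d)) := by
    have h1 : IntegrableOn (fun _ : Fin d → ℝ => (1 : ℂ)) (cube d) := by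
      rw [IntegrableOn, volume_restrict_cube_eq]; exact integrable_const _
    have h2 := integrableOn_latticeFT_mul hf h1
    simp only [mul_one] at h2
    exact integrableOn_cexp_kdot_mul h2 x
  have hre : ∀ k : Fin d → ℝ, (Complex.exp (Complex.I * (kdot k x : ℂ)) * latticeFT f k).re =
      cosFT f k * Real.cos (kdot k x) := by
    intro k
    rw [latticeFT_eq_ofReal_cosFT hf hfe, show Complex.I * (kdot k x : ℂ) = ((kdot k x : ℝ) : ℂ) * Complex.I by
      ring, Complex.re_mul_ofReal, Complex.exp_ofReal_mul_I_re, mul_comm]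
  have h1 := integral_re hint
  simp only [RCLike.re_to_complex, hre] at h1
  rw [h1, h]
  norm_cast

/-- **`‖f‖_∞ ≤ ‖f̂‖₁`** ("the general fact that `‖f‖_∞ ≤ ‖f̂‖₁`", used in (5.12) and (5.43)): for an
even `f ∈ ℓ¹` and every `x`, `(2π)^d |f(x)| ≤ ∫_{[-π,π]^d} |f̂(k)| dk`.
[cite: Slade2006LaceExpansion, §5.1, eq. (5.12)] -/
theorem abs_le_integral_abs_cosFT (hf : Summable fun x => |f x|) (hfe : Function.Even f)
    (x : Site d) : (2 * π) ^ d * |f x| ≤ ∫ k in cube d, |cosFT f k| := by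
  have h := integral_cosFT_mul_cos hf hfe x
  have hpos : (0 : ℝ) < (2 * π) ^ d := by positivity
  rw [← abs_of_pos hpos, ← abs_mul, ← h]
  refine (abs_integral_le_integral_abs).trans (integral_mono_of_nonneg (ae_of_all _ fun _ =>
    abs_nonneg _) ?_ (ae_of_all _ fun k => ?_))
  · rw [volume_restrict_cube_eq]
    exact (integrable_of_norm_le (continuous_cosFT hf) (C := ∑' y, |f y|) fun k => by
      rw [Real.norm_eq_abs]; exact abs_cosFT_le hf.of_abs k).abs
  · dsimp only
    rw [abs_mul]
    exact mul_le_of_le_one_right (abs_nonneg _) (abs_cos_le_one _)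

/-- **Parseval, real form** ((2.31)): for an even `f ∈ ℓ¹`,
`∫_{[-π,π]^d} f̂(k)² dk = (2π)^d Σ_x f(x)²` (from the tree's `tsum_enorm_sq_eq_lintegral_latticeFT`).
[cite: Slade2006LaceExpansion, eq. (2.31)] -/
theorem integral_cosFT_sq (hf : Summable fun x => |f x|) (hfe : Function.Even f) :
    ∫ k in cube d, cosFT f k ^ 2 = (2 * π) ^ d * ∑' x, f x ^ 2 := by
  have hP := tsum_enorm_sq_eq_lintegral_latticeFT hf
  -- the left side of Parseval: `Σ ‖f x‖ₑ² = ofReal (Σ f²)`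
  have hsq : Summable fun x => f x ^ 2 := by
    refine .of_norm_bounded (g := fun x => (∑' u, |f u|) * |f x|) (hf.mul_left _) fun x => ?_
    rw [Real.norm_eq_abs, abs_pow, pow_two]
    exact mul_le_mul_of_nonneg_right (hf.le_tsum x fun _ _ => abs_nonneg _) (abs_nonneg _)
  have hL : ∑' x, ‖f x‖ₑ ^ 2 = ENNReal.ofReal (∑' x, f x ^ 2) := by
    rw [ENNReal.ofReal_tsum_of_nonneg (fun x => sq_nonneg _) hsq]
    refine tsum_congr fun x => ?_
    rw [Real.enorm_eq_ofReal_abs, ← ENNReal.ofReal_pow (abs_nonneg _), sq_abs]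
  -- the right side: `∫⁻ ‖f̂‖ₑ² = ofReal (∫ (cosFT f)²)`
  have hint : Integrable (fun k => cosFT f k ^ 2) (volume.restrict (cube d)) := by
    rw [volume_restrict_cube_eq]
    exact integrable_of_norm_le ((continuous_cosFT hf).pow 2) (C := (∑' y, |f y|) ^ 2) fun k => by
      rw [Real.norm_eq_abs, abs_pow]
      exact pow_le_pow_left₀ (abs_nonneg _) (abs_cosFT_le hf.of_abs k) 2
  have hR : ∫⁻ k in cube d, ‖latticeFT f k‖ₑ ^ 2 = ENNReal.ofReal (∫ k in cube d, cosFT f k ^ 2) := by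
    rw [ofReal_integral_eq_lintegral_ofReal hint (ae_of_all _ fun k => sq_nonneg _)]
    refine lintegral_congr fun k => ?_
    rw [latticeFT_eq_ofReal_cosFT hf hfe, ← ofReal_norm, Complex.norm_real, Real.norm_eq_abs,
      ← ENNReal.ofReal_pow (abs_nonneg _), sq_abs]
  rw [hL, hR, ← ENNReal.ofReal_mul (by positivity)] at hP
  have hP' := (ENNReal.ofReal_eq_ofReal_iff (tsum_nonneg fun x => sq_nonneg _)
    (mul_nonneg (by positivity) (integral_nonneg fun k => sq_nonneg _))).1 hP
  have hpos : (0 : ℝ) < (2 * π) ^ d := by positivity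
  rw [hP']
  field_simp

end Inversion

/-! ### Modulation and the second difference `-½ Δ_k` ((5.11)–(5.14)) -/

section Modulation

variable {f : Site d → ℝ}

/-- `-½ Δ_k Â(l) = Â(l) - ½ (Â(l + k) + Â(l - k))`, the (negative half) second difference of a
function on `k`-space in direction `k` (the tree's `secondDiffTauHat` is `-2` times this for `τ̂`).
[cite: Slade2006LaceExpansion, eq. (5.13)] -/
def halfNegLap (A : (Fin d → ℝ) → ℝ) (k l : Fin d → ℝ) : ℝ := A l - (A (l + k) + A (l - k)) / 2

/-- The modulation identity (5.11)/(5.19): for `f ∈ ℓ¹`,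
`Σ_x f(x) cos(l·x) cos(k·x) = ½ [f̂(l - k) + f̂(l + k)]`.
[cite: Slade2006LaceExpansion, eqs. (5.11), (5.19)] -/
theorem tsum_mul_cos_mul_cos (hf : Summable fun x => |f x|) (k l : Fin d → ℝ) :
    ∑' x, f x * Real.cos (kdot l x) * Real.cos (kdot k x) = (cosFT f (l - k) + cosFT f (l + k)) / 2 := by
  have h : ∀ x, f x * Real.cos (kdot l x) * Real.cos (kdot k x) =
      (1 / 2) * (Real.cos (kdot (l - k) x) * f x) + (1 / 2) * (Real.cos (kdot (l + k) x) * f x) := by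
    intro x
    rw [kdot_sub_left, kdot_add_left, Real.cos_sub, Real.cos_add]
    ring
  rw [tsum_congr h, ((summable_cos_kdot_mul hf.of_abs _).mul_left _).tsum_add
    ((summable_cos_kdot_mul hf.of_abs _).mul_left _), tsum_mul_left, tsum_mul_left]
  unfold cosFT
  ring

/-- `x ↦ [1 - cos(k·x)] f(x)` is in `ℓ¹` when `f` is. [folklore] -/
theorem summable_abs_one_sub_cos_mul (hf : Summable fun x => |f x|) (k : Fin d → ℝ) :
    Summable fun x => |(1 - Real.cos (kdot k x)) * f x| := by
  refine .of_nonneg_of_le (fun _ => abs_nonneg _) (fun x => ?_) (hf.mul_left 2)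
  rw [abs_mul]
  gcongr
  rw [abs_le]
  constructor <;> linarith [Real.cos_le_one (kdot k x), Real.neg_one_le_cos (kdot k x)]

/-- `x ↦ [1 - cos(k·x)] f(x)` is even when `f` is. [folklore] -/
theorem even_one_sub_cos_mul (hfe : Function.Even f) (k : Fin d → ℝ) :
    Function.Even fun x => (1 - Real.cos (kdot k x)) * f x := by
  intro x
  simp only [kdot_neg, Real.cos_neg, hfe x]

/-- The transform of `[1 - cos(k·x)] f(x)` is `-½ Δ_k f̂` ((5.11)–(5.13)): for `f ∈ ℓ¹`,
`Σ_x cos(l·x) [1 - cos(k·x)] f(x) = f̂(l) - ½[f̂(l+k) + f̂(l-k)]`.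
[cite: Slade2006LaceExpansion, eqs. (5.11)–(5.13)] -/
theorem cosFT_one_sub_cos_mul (hf : Summable fun x => |f x|) (k l : Fin d → ℝ) :
    cosFT (fun x => (1 - Real.cos (kdot k x)) * f x) l = halfNegLap (cosFT f) k l := by
  unfold halfNegLap
  have h1 : ∀ x, Real.cos (kdot l x) * ((1 - Real.cos (kdot k x)) * f x) =
      Real.cos (kdot l x) * f x - f x * Real.cos (kdot l x) * Real.cos (kdot k x) := fun x => by ring
  have hs2 : Summable fun x => f x * Real.cos (kdot l x) * Real.cos (kdot k x) := by
    refine .of_norm_bounded hf fun x => ?_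
    rw [norm_mul, norm_mul, Real.norm_eq_abs, Real.norm_eq_abs, Real.norm_eq_abs]
    calc |f x| * |Real.cos (kdot l x)| * |Real.cos (kdot k x)| ≤ |f x| * 1 * 1 := by
          gcongr <;> exact abs_cos_le_one _
      _ = |f x| := by ring
  unfold cosFT
  rw [tsum_congr h1, (summable_cos_kdot_mul hf.of_abs l).tsum_sub hs2, tsum_mul_cos_mul_cos hf k l]
  unfold cosFT
  ring

/-- (5.12)/(5.14)/(5.39): `‖[1 - cos(k·x)] f(x)‖_∞ ≤ ½ ‖Δ_k f̂‖₁` — for an even `f ∈ ℓ¹`, every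
`k` and `x`, `(2π)^d |[1 - cos(k·x)] f(x)| ≤ ∫_{[-π,π]^d} |-½ Δ_k f̂(l)| dl`.
[cite: Slade2006LaceExpansion, eqs. (5.12), (5.14)] -/
theorem abs_one_sub_cos_mul_le (hf : Summable fun x => |f x|) (hfe : Function.Even f)
    (k : Fin d → ℝ) (x : Site d) :
    (2 * π) ^ d * |(1 - Real.cos (kdot k x)) * f x| ≤ ∫ l in cube d, |halfNegLap (cosFT f) k l| := by
  have h := abs_le_integral_abs_cosFT (summable_abs_one_sub_cos_mul hf k) (even_one_sub_cos_mul hfe k) x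
  simp_rw [cosFT_one_sub_cos_mul hf] at h
  exact h

/-- `-½ Δ_k A` is continuous in `l` for continuous `A`. [folklore] -/
theorem continuous_halfNegLap {A : (Fin d → ℝ) → ℝ} (hA : Continuous A) (k : Fin d → ℝ) :
    Continuous (halfNegLap A k) := by
  unfold halfNegLap; fun_prop

/-- `|½ Δ_k A(l)| ≤ 2 sup |A|`. [folklore] -/
theorem abs_halfNegLap_le {A : (Fin d → ℝ) → ℝ} {C : ℝ} (hA : ∀ m, |A m| ≤ C) (k l : Fin d → ℝ) :
    |halfNegLap A k l| ≤ 2 * C := by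
  unfold halfNegLap
  have h1 := hA l; have h2 := hA (l + k); have h3 := hA (l - k)
  rw [abs_le] at h1 h2 h3 ⊢
  constructor <;> linarith

end Modulation

/-! ### Translation invariance on the torus `[-π,π]^d` -/

section Shift

/-- **Translation invariance of cube integrals of periodic functions**: if `F ≥ 0` is measurable
and `2π`-periodic in every coordinate, then `∫_{[-π,π]^d} F(l + k) dl = ∫_{[-π,π]^d} F(l) dl`
(the change of variables `l ↦ l + k` on the torus `(ℝ/2πℤ)^d`: the quotient map is measure
preserving from `(-π,π]^d` onto the Haar torus, which is translation invariant). Used for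
`∫ Ĉ(l ± k)² dl = ‖Ĉ‖₂²` in (5.18) and (5.40). [folklore] -/
theorem lintegral_cube_comp_add (F : (Fin d → ℝ) → ℝ≥0∞) (hF : Measurable F)
    (hper : ∀ (l : Fin d → ℝ) (n : Fin d → ℤ), F (fun j => l j + 2 * π * n j) = F l)
    (k : Fin d → ℝ) : ∫⁻ l in cube d, F (l + k) = ∫⁻ l in cube d, F l := by
  haveI : Fact (0 < 2 * π) := ⟨Real.two_pi_pos⟩
  -- the section `AddCircle (2π) → (-π, π]` and the lift of `F` to the torus
  set sec : AddCircle (2 * π) → ℝ := fun θ => (AddCircle.equivIoc (2 * π) (-π) θ : ℝ) with hsec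
  set Fbar : (Fin d → AddCircle (2 * π)) → ℝ≥0∞ := fun θ => F fun j => sec (θ j) with hFbar
  have hsec_meas : Measurable sec :=
    measurable_subtype_coe.comp (AddCircle.measurableEquivIoc (2 * π) (-π)).measurable
  have hFbar_meas : Measurable Fbar :=
    hF.comp (measurable_pi_lambda _ fun j => hsec_meas.comp (measurable_pi_apply j))
  have hlift : ∀ l : Fin d → ℝ, Fbar (fun j => ((l j : ℝ) : AddCircle (2 * π))) = F l := by
    intro l
    have hn : ∀ j, ∃ n : ℤ, sec ((l j : ℝ) : AddCircle (2 * π)) = l j + 2 * π * n := by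
      intro j
      have h1 : ((sec ((l j : ℝ) : AddCircle (2 * π)) : ℝ) : AddCircle (2 * π)) = (l j : AddCircle (2 * π)) :=
        AddCircle.coe_equivIoc
      rw [← sub_eq_zero, ← AddCircle.coe_sub, AddCircle.coe_eq_zero_iff] at h1
      obtain ⟨n, hn⟩ := h1
      refine ⟨n, ?_⟩
      rw [zsmul_eq_mul] at hn
      linarith
    choose n hn using hn
    change F (fun j => sec ((l j : ℝ) : AddCircle (2 * π))) = F l
    rw [show (fun j => sec ((l j : ℝ) : AddCircle (2 * π))) = fun j => l j + 2 * π * n j from funext hn]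
    exact hper l n
  -- measure preservation of the quotient map on `(-π, π]^d`
  have hmp : MeasurePreserving (fun (l : Fin d → ℝ) (j : Fin d) => ((l j : ℝ) : AddCircle (2 * π)))
      (Measure.pi fun _ : Fin d => volume.restrict (Set.Ioc (-π) (-π + 2 * π)))
      (Measure.pi fun _ : Fin d => (volume : Measure (AddCircle (2 * π)))) :=
    measurePreserving_pi _ _ fun _ => AddCircle.measurePreserving_mk (2 * π) (-π)
  have hP : (volume.restrict (cube d) : Measure (Fin d → ℝ)) =
      Measure.pi fun _ : Fin d => volume.restrict (Set.Ioc (-π) (-π + 2 * π)) := by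
    rw [volume_restrict_cube_eq]
    unfold P μI
    congr 1
    funext j
    rw [show -π + 2 * π = π by ring]
    exact Measure.restrict_congr_set Ioc_ae_eq_Icc.symm
  rw [hP]
  set ν : Measure (Fin d → ℝ) :=
    Measure.pi fun _ : Fin d => volume.restrict (Set.Ioc (-π) (-π + 2 * π)) with hν
  set τ : Measure (Fin d → AddCircle (2 * π)) :=
    Measure.pi fun _ : Fin d => (volume : Measure (AddCircle (2 * π))) with hτ
  set κ : Fin d → AddCircle (2 * π) := fun j => ((k j : ℝ) : AddCircle (2 * π)) with hκ
  calc ∫⁻ l, F (l + k) ∂ν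
      = ∫⁻ l, (fun θ => Fbar (κ + θ)) (fun j => ((l j : ℝ) : AddCircle (2 * π))) ∂ν := by
        refine lintegral_congr fun l => ?_
        rw [← hlift (l + k)]
        simp only [hκ]
        congr 1
        funext j
        simp only [Pi.add_apply, AddCircle.coe_add]
        exact add_comm _ _
    _ = ∫⁻ θ, Fbar (κ + θ) ∂τ := hmp.lintegral_comp (hFbar_meas.comp (measurable_const_add κ))
    _ = ∫⁻ θ, Fbar θ ∂τ := lintegral_add_left_eq_self _ κ
    _ = ∫⁻ l, Fbar (fun j => ((l j : ℝ) : AddCircle (2 * π))) ∂ν :=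
        (hmp.lintegral_comp hFbar_meas).symm
    _ = _ := lintegral_congr fun l => hlift l

/-- Translation invariance, subtractive form: `∫ F(l - k) dl = ∫ F(l) dl`. [folklore] -/
theorem lintegral_cube_comp_sub (F : (Fin d → ℝ) → ℝ≥0∞) (hF : Measurable F)
    (hper : ∀ (l : Fin d → ℝ) (n : Fin d → ℤ), F (fun j => l j + 2 * π * n j) = F l)
    (k : Fin d → ℝ) : ∫⁻ l in cube d, F (l - k) = ∫⁻ l in cube d, F l := by
  simpa [sub_eq_add_neg] using lintegral_cube_comp_add F hF hper (-k)

end Shift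

end LaceExpansion

end Literature.Barriers.CriticalPhenomena
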